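/-
Copyright (c) 2026. All rights reserved.
Released under Apache 2.0 license as described in the file LICENSE.
Authors: abc-iut cell, prover seat abc-iut-w4-d095 (gen 7; row «SB′-CONTACT», abc-iut-L4-lead m136), over abc-iut-f-101's
frames of the telecore diagram (`LogFrobeniusMonoTelecoreFrames/FrameIsos/FrameLifts/Postcomp`, `DiagramRelativeFamilies`) and
this seat's `LogFrobeniusObservablesCoreChains` / `LogFrobeniusMonoTelecoreLamLifts` (nothing of those files is restated).
-/
import Literature.AnabelianGeometry.AbsoluteAnabelian.LogFrobeniusMonoTelecoreLamLifts
import HarnessLib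

/-!
# [AbsTopIII] Cor 5.10 (iv)(c): the relative lifts at the vertices `𝒩⊞_v` of `D_{An⊢}` — the homotopies and their four laws

S. Mochizuki, *Topics in absolute anabelian geometry III: global reconstruction algorithms*,
J. Math. Sci. Univ. Tokyo 22 (2015) 939–1156 [MochizukiAbsTopIII2015]; manuscript `paper:url-5493eb38cbb7`: Cor 5.10
(iv)(c) p. 148, Cor 5.5 (iii) p. 131 (`S_log⊞`: the pairs `([λ⊞_{v,ν₁}], [λ⊞_{v,ν₂}])` with homotopy `ι⊞_{v,ε}`), Def 3.5 (ii)
p. 75 / §0 p. 26 (saturation), Rmk 3.5.1 p. 78 (homotopies over the "constant portion").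

Second half of brick C₁ of row «SB′-CONTACT» (the relation `NRel` at `{𝒩⊞_v}` is in `LogFrobeniusMonoTelecoreLamLifts`):
* `lamChainD` — `ι⊞` along a chain read between the DIAGRAM's functors (bookkeeping); `θN` — the homotopy
  `𝒟_[ρ] ◁ (ι⊞ along ν₁ ⤳ ν₂)` of a related pair, with the four laws of Def 3.5 (ii): `θN_self`, `θN_trans` (UNDER the `ι⊞`-square
  `IotaCoreSquaresCommute`), `θN_precomp_heq`, `θN_postcomp_heq`; ★ `lamRelLifts` — the `RelLifts` datum of the `ι⊞`-pairs of
  `S_log⊞` at `{𝒩⊞_v}` (abc-iut-f-101's `DiagramRelativeFamilies`);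
* `nrelN_lamE`, `θN_lamE_app_heq` — the core-edge generator pair is related, homotopy the untwisted `ι⊞_{v,ε}`;
* ★ `θN_over` — GIVEN abc-iut-L4-t3's `IotaOver`, the homotopies lie over abc-iut-f-101's structure isomorphisms (Rmk 3.5.1).
Refereed pre-IUT material; OUR constructions over a typed interface and its typed add-ons; nothing here bears on [IUTchIII]
Cor. 3.12; no side taken; typed ≠ proved.
-/

set_option autoImplicit false

universe u

open CategoryTheory Quiver

namespace Literature.AnabelianGeometry.AbsoluteAnabelian

namespace LogFrobeniusSetting

variable {Vmod : Type u} {isArc : Vmod → Bool}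

/-! ## The homotopy of a related pair and its four laws -/

section Theta

variable (L : LogFrobeniusSetting Vmod isArc) {v : Vmod} {a : (monoTeleShape Vmod isArc).Vertex}

/-- `ι⊞` along a chain, READ between the diagram's functors `D_{An⊢}(λ⊞_{v,ν₁}) ⟶ D_{An⊢}(λ⊞_{v,ν₂})` (the same natural transformation
`lamChain`; bookkeeping so that whiskering by the diagram's path functors is well-typed on the nose).
[cite: MochizukiAbsTopIII2015, Cor 5.5 (iii) p. 131] -/
def lamChainD (v : Vmod) {ν₁ ν₂ : LogVertex (isArc v)} (h : ν₁.Reach ν₂) :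
    L.monoTeleDiagram.map (lamE v ν₁ h.isCross_src) ⟶ L.monoTeleDiagram.map (lamE v ν₂ h.isCross_tgt) :=
  L.lamChain v h

/-- its components are those of `lamChain`. [cite: MochizukiAbsTopIII2015, Cor 5.5 (iii) p. 131] -/
theorem lamChainD_app (v : Vmod) {ν₁ ν₂ : LogVertex (isArc v)} (h : ν₁.Reach ν₂) (y : L.X) :
    (L.lamChainD v h).app y = (L.lamChain v h).app y := rfl

/-- on the diagonal it is the identity. [cite: MochizukiAbsTopIII2015, Cor 5.5 (iii) p. 131] -/
theorem lamChainD_refl (v : Vmod) {ν : LogVertex (isArc v)} (h : ν.Reach ν) : L.lamChainD v h = 𝟙 _ :=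
  L.lamChain_refl v h

/-- transitivity under the square. [cite: MochizukiAbsTopIII2015, Cor 5.5 (iii) p. 131] -/
theorem lamChainD_trans (v : Vmod) (hsq : L.IotaCoreSquaresCommute v) {ν₁ ν₂ ν₃ : LogVertex (isArc v)}
    (h₁₂ : ν₁.Reach ν₂) (h₂₃ : ν₂.Reach ν₃) (h₁₃ : ν₁.Reach ν₃) :
    L.lamChainD v h₁₂ ≫ L.lamChainD v h₂₃ = L.lamChainD v h₁₃ :=
  L.lamChain_trans v hsq h₁₂ h₂₃ h₁₃

variable {ν₁ ν₂ : LogVertex (isArc v)} {hν₁ : ν₁.IsCross} {hν₂ : ν₂.IsCross}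

/-- the functor of the left path of a witness: `𝒟_[ρ] ⋙ D(λ⊞_{v,ν₁})`. [cite: MochizukiAbsTopIII2015, Definition 3.5 (i) p.75] -/
theorem NWit.pathFunctor_left {p q : Path a (nplusVx (isArc := isArc) v)} (w : NWit v ν₁ ν₂ hν₁ hν₂ p q) :
    L.monoTeleDiagram.pathFunctor p = L.monoTeleDiagram.pathFunctor w.R ⋙ L.monoTeleDiagram.map (lamE v ν₁ hν₁) := by
  obtain ⟨R, rfl, rfl⟩ := w
  exact DiagramOfCategories.pathFunctor_cons _ _ _

/-- the functor of the right path of a witness: `𝒟_[ρ] ⋙ D(λ⊞_{v,ν₂})`. [cite: MochizukiAbsTopIII2015, Definition 3.5 (i) p.75] -/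
theorem NWit.pathFunctor_right {p q : Path a (nplusVx (isArc := isArc) v)} (w : NWit v ν₁ ν₂ hν₁ hν₂ p q) :
    L.monoTeleDiagram.pathFunctor q = L.monoTeleDiagram.pathFunctor w.R ⋙ L.monoTeleDiagram.map (lamE v ν₂ hν₂) := by
  obtain ⟨R, rfl, rfl⟩ := w
  exact DiagramOfCategories.pathFunctor_cons _ _ _

/-- **the homotopy of a witnessed pair along `ν₁ ⤳ ν₂`**: `𝒟_[ρ] ◁ (ι⊞ along the chain)` (Def 3.5 (ii) (d): pre-composition by
`[ρ]`; (c): the composite along the chain). [cite: MochizukiAbsTopIII2015, Definition 3.5 (ii) p.75] -/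
noncomputable def NWit.θ {p q : Path a (nplusVx (isArc := isArc) v)} (w : NWit v ν₁ ν₂ hν₁ hν₂ p q) (h : ν₁.Reach ν₂) :
    L.monoTeleDiagram.pathFunctor p ⟶ L.monoTeleDiagram.pathFunctor q :=
  eqToHom (w.pathFunctor_left L) ≫ Functor.whiskerLeft (L.monoTeleDiagram.pathFunctor w.R) (L.lamChainD v h) ≫
    eqToHom (w.pathFunctor_right L).symm

/-- the homotopy is, heterogeneously, the whiskered chain. [cite: MochizukiAbsTopIII2015, Definition 3.5 (ii) p.75] -/
theorem NWit.θ_heq {p q : Path a (nplusVx (isArc := isArc) v)} (w : NWit v ν₁ ν₂ hν₁ hν₂ p q) (h : ν₁.Reach ν₂) :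
    w.θ L h ≍ Functor.whiskerLeft (L.monoTeleDiagram.pathFunctor w.R) (L.lamChainD v h) :=
  (conj_eqToHom_iff_heq _ _ (w.pathFunctor_left L) (w.pathFunctor_right L)).mp rfl

/-- components of the homotopy: the component of `ι⊞` along the chain at `𝒟_[ρ](x)`, between the casts.
[cite: MochizukiAbsTopIII2015, Definition 3.5 (ii) p.75] -/
theorem NWit.θ_app {p q : Path a (nplusVx (isArc := isArc) v)} (w : NWit v ν₁ ν₂ hν₁ hν₂ p q) (h : ν₁.Reach ν₂)
    (x : L.monoTeleDiagram.obj a) :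
    (w.θ L h).app x = eqToHom (Functor.congr_obj (w.pathFunctor_left L) x) ≫
      (L.lamChainD v h).app ((L.monoTeleDiagram.pathFunctor w.R).obj x) ≫
        eqToHom (Functor.congr_obj (w.pathFunctor_right L).symm x) := by
  rw [NWit.θ, NatTrans.comp_app, NatTrans.comp_app, eqToHom_app, eqToHom_app, Functor.whiskerLeft_app]
  rfl

/-- components of the homotopy, the casts stripped. [cite: MochizukiAbsTopIII2015, Definition 3.5 (ii) p.75] -/
theorem NWit.θ_app_heq {p q : Path a (nplusVx (isArc := isArc) v)} (w : NWit v ν₁ ν₂ hν₁ hν₂ p q) (h : ν₁.Reach ν₂)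
    (x : L.monoTeleDiagram.obj a) :
    (w.θ L h).app x ≍ (L.lamChain v h).app ((L.monoTeleDiagram.pathFunctor w.R).obj x) := by
  rw [NWit.θ_app]
  exact (eqToHom_comp_heq _ _).trans (comp_eqToHom_heq _ _)

open scoped Classical in
/-- **the homotopy of a related pair at `𝒩⊞_v`** (independent of the chosen data: the vertices are determined by the paths and
the witness is unique, `θN_eq`). [cite: MochizukiAbsTopIII2015, Definition 3.5 (ii) p.75] -/
noncomputable def θN {p q : Path a (nplusVx (isArc := isArc) v)} (h : NRelN v p q) :
    L.monoTeleDiagram.pathFunctor p ⟶ L.monoTeleDiagram.pathFunctor q :=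
  (Classical.choice h.choose_spec.choose_spec.choose_spec.choose_spec.2).θ L
    h.choose_spec.choose_spec.choose_spec.choose_spec.1

/-- computed from ANY witness and chain. [cite: MochizukiAbsTopIII2015, Definition 3.5 (ii) p.75] -/
theorem θN_eq {p q : Path a (nplusVx (isArc := isArc) v)} (h : NRelN v p q) (w : NWit v ν₁ ν₂ hν₁ hν₂ p q)
    (hr : ν₁.Reach ν₂) : L.θN h = w.θ L hr := by
  obtain rfl : ν₁ = h.choose :=
    NWit.ν_eq_left w (Classical.choice h.choose_spec.choose_spec.choose_spec.choose_spec.2)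
  obtain rfl : ν₂ = h.choose_spec.choose :=
    NWit.ν_eq_right w (Classical.choice h.choose_spec.choose_spec.choose_spec.choose_spec.2)
  unfold θN
  rw [NWit.eq_of (Classical.choice h.choose_spec.choose_spec.choose_spec.choose_spec.2) w]

/-- **identity law** (Def 3.5 (ii): `ζ_{([γ],[γ])} = 1`; `ι⊞` along `ν ⤳ ν` is the identity).
[cite: MochizukiAbsTopIII2015, Definition 3.5 (ii) p.75] -/
theorem θN_self {p : Path a (nplusVx (isArc := isArc) v)} (h : NRelN v p p) : L.θN h = 𝟙 _ := by
  obtain ⟨μ₁, μ₂, hμ₁, hμ₂, hreach, ⟨w⟩⟩ := h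
  obtain rfl : μ₁ = μ₂ := NWit.ν_eq_of_cons_eq (w.left_eq.symm.trans w.right_eq)
  rw [L.θN_eq _ w hreach]
  obtain ⟨R, rfl, hr⟩ := w
  simp only [NWit.θ, L.lamChainD_refl, Functor.whiskerLeft_id', Category.id_comp, eqToHom_trans, eqToHom_refl]

/-- **composition law** (Def 3.5 (ii): `ζ_{ϖ″} = ζ_{ϖ′} ∘ ζ_ϖ`), GIVEN the `ι⊞`-square at `v`.
[cite: MochizukiAbsTopIII2015, Definition 3.5 (ii) p.75] -/
theorem θN_trans (hsq : L.IotaCoreSquaresCommute v) {p q r : Path a (nplusVx (isArc := isArc) v)} (h₁ : NRelN v p q)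
    (h₂ : NRelN v q r) (h₃ : NRelN v p r) : L.θN h₁ ≫ L.θN h₂ = L.θN h₃ := by
  obtain ⟨μ₁, μ₂, hμ₁, hμ₂, h12, ⟨w₁⟩⟩ := h₁
  obtain ⟨μ₂', μ₃, hμ₂', hμ₃, h23, ⟨w₂⟩⟩ := h₂
  obtain rfl : μ₂ = μ₂' := NWit.ν_eq_mid w₁ w₂
  rw [L.θN_eq _ w₁ h12, L.θN_eq _ w₂ h23, L.θN_eq _ (w₁.trans w₂) (LogVertex.Reach.trans h12 h23)]
  obtain ⟨R, rfl, rfl⟩ := w₁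
  obtain ⟨R', hl', rfl⟩ := w₂
  obtain rfl : R = R' := NWit.R_eq_of_cons_eq hl'
  simp only [NWit.trans, NWit.θ, Category.assoc, eqToHom_trans_assoc, eqToHom_refl, Category.id_comp]
  rw [← Category.assoc (Functor.whiskerLeft _ _), ← Functor.whiskerLeft_comp, L.lamChainD_trans v hsq]

/-- whiskering on the left respects heterogeneous equality along an equality of the whiskering functor (bookkeeping for
`𝒟_[σ∘γ] = 𝒟_[σ] ∘ 𝒟_[γ]`). (bookkeeping for `𝒟_[σ∘γ] = 𝒟_[σ] ∘ 𝒟_[γ]`). [cite: MochizukiAbsTopIII2015, Definition 3.5 (i) p.75] -/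
theorem whiskerLeft_heq_of_eq_functor {A B C : Type*} [Category A] [Category B] [Category C] {F F' : A ⥤ B} (hF : F = F')
    {G H : B ⥤ C} (α : G ⟶ H) : Functor.whiskerLeft F α ≍ Functor.whiskerLeft F' α := by
  subst hF
  rfl

/-- whiskering on the left respects heterogeneous equality of the whiskered transformation (bookkeeping). (bookkeeping for `𝒟_[σ∘γ] = 𝒟_[σ] ∘ 𝒟_[γ]`). [cite: MochizukiAbsTopIII2015, Definition 3.5 (i) p.75] -/
theorem whiskerLeft_heq_of_heq {A B C : Type*} [Category A] [Category B] [Category C] (F : A ⥤ B)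
    {G H G' H' : B ⥤ C} (hG : G = G') (hH : H = H') {α : G ⟶ H} {α' : G' ⟶ H'} (h : α ≍ α') :
    Functor.whiskerLeft F α ≍ Functor.whiskerLeft F α' := by
  subst hG hH
  cases h
  rfl

/-- **pre-composition law** (§0 (d), Def 3.5 (ii) whiskering): the homotopy of the pre-composed pair is the homotopy whiskered on
the left by `𝒟_[r]`, heterogeneously. [cite: MochizukiAbsTopIII2015, Definition 3.5 (ii) p.75] -/
theorem θN_precomp_heq {c : (monoTeleShape Vmod isArc).Vertex} (r : Path c a) {p q : Path a (nplusVx (isArc := isArc) v)}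
    (h : NRelN v p q) (h' : NRelN v (r.comp p) (r.comp q)) :
    L.θN h' ≍ Functor.whiskerLeft (L.monoTeleDiagram.pathFunctor r) (L.θN h) := by
  obtain ⟨μ₁, μ₂, hμ₁, hμ₂, hreach, ⟨w⟩⟩ := h
  rw [L.θN_eq _ w hreach, L.θN_eq _ (w.precomp r) hreach]
  obtain ⟨R, rfl, rfl⟩ := w
  refine ((NWit.precomp r ⟨R, rfl, rfl⟩).θ_heq L hreach).trans ?_
  change Functor.whiskerLeft (L.monoTeleDiagram.pathFunctor (r.comp R)) (L.lamChainD v hreach) ≍ _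
  refine (whiskerLeft_heq_of_eq_functor (DiagramOfCategories.pathFunctor_comp _ r R) _).trans ?_
  -- `(𝒟_[r] ∘ 𝒟_[R]) ◁ c = 𝒟_[r] ◁ (𝒟_[R] ◁ c)` on the nose
  refine HEq.trans (b := Functor.whiskerLeft (L.monoTeleDiagram.pathFunctor r)
    (Functor.whiskerLeft (L.monoTeleDiagram.pathFunctor R) (L.lamChainD v hreach))) HEq.rfl ?_
  -- `𝒟_[r] ◁ (𝒟_[R] ◁ c) ≍ 𝒟_[r] ◁ θ` from `θ ≍ 𝒟_[R] ◁ c` by congruence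
  exact whiskerLeft_heq_of_heq _ (DiagramOfCategories.pathFunctor_cons _ _ _).symm
    (DiagramOfCategories.pathFunctor_cons _ _ _).symm
    (NWit.θ_heq L (⟨R, rfl, rfl⟩ : NWit v μ₁ μ₂ hμ₁ hμ₂ _ _) hreach).symm

/-- right whiskering by the identity functor does nothing (bookkeeping for the empty path). [cite: MochizukiAbsTopIII2015, Definition 3.5 (i) p.75] -/
theorem whiskerRight_id_functor_eq {A B : Type*} [Category A] [Category B] {F G : A ⥤ B} (α : F ⟶ G) :
    Functor.whiskerRight α (𝟭 B) = α :=
  NatTrans.ext (funext fun _ => rfl)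

/-- **post-composition law INSIDE the vertex set** (§0 (e)): only the empty path stays inside `{𝒩⊞_v}`, along which nothing
happens. [cite: MochizukiAbsTopIII2015, Definition 3.5 (ii) p.75] -/
theorem θN_postcomp_heq {p q : Path a (nplusVx (isArc := isArc) v)} (t : Path (nplusVx (isArc := isArc) v) (nplusVx v))
    (h : NRelN v p q) (h' : NRelN v (p.comp t) (q.comp t)) :
    L.θN h' ≍ Functor.whiskerRight (L.θN h) (L.monoTeleDiagram.pathFunctor t) := by
  obtain rfl := eq_nil_of_path_nplus t
  rw [DiagramOfCategories.pathFunctor_nil, whiskerRight_id_functor_eq]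
  rfl

/-! ## The relative-lift datum at `{𝒩⊞_v}` -/

/-- the vertex-indexed homotopy (at `𝒩⊞_v`: `θN`). [cite: MochizukiAbsTopIII2015, Definition 3.5 (ii) p.75] -/
noncomputable def NθAt : ∀ ⦃a w : (monoTeleShape Vmod isArc).Vertex⦄, NW w → ∀ ⦃p q : Path a w⦄, NRel p q →
    (L.monoTeleDiagram.pathFunctor p ⟶ L.monoTeleDiagram.pathFunctor q)
  | _, ExtVertex.base ⟨.nplus _, _⟩, _, _, _, h => L.θN h
  | _, ExtVertex.base ⟨.row1 _, _⟩, hw, _, _, _ => hw.elim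
  | _, ExtVertex.base ⟨.core, _⟩, hw, _, _, _ => hw.elim
  | _, ExtVertex.base ⟨.nv _, _⟩, hw, _, _, _ => hw.elim
  | _, ExtVertex.base ⟨.e5, _⟩, hw, _, _, _ => hw.elim
  | _, ExtVertex.base ⟨.an, _⟩, hw, _, _, _ => hw.elim
  | _, ExtVertex.base ⟨.e7, _⟩, hw, _, _, _ => hw.elim
  | _, ExtVertex.base ⟨.nmonoPlus _, _⟩, hw, _, _, _ => hw.elim
  | _, ExtVertex.base ⟨.nmono _, _⟩, hw, _, _, _ => hw.elim
  | _, ExtVertex.base ⟨.emono5, _⟩, hw, _, _, _ => hw.elim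
  | _, ExtVertex.base ⟨.anMono, _⟩, hw, _, _, _ => hw.elim
  | _, ExtVertex.base ⟨.emono7, _⟩, hw, _, _, _ => hw.elim
  | _, ExtVertex.obs, hw, _, _, _ => hw.elim

/-- at `𝒩⊞_v` the vertex-indexed homotopy is `θN`. [cite: MochizukiAbsTopIII2015, Definition 3.5 (ii) p.75] -/
theorem NθAt_nplus (hw : NW (nplusVx (isArc := isArc) v)) {p q : Path a (nplusVx (isArc := isArc) v)} (h : NRel p q) :
    L.NθAt hw h = L.θN h := rfl

end Theta

/-- ★ **the relative-lift datum of the `ι⊞`-pairs of `S_log⊞` inside `D_{An⊢}`**: vertex set `{𝒩⊞_v}`, related pairs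
`([λ⊞_{v,ν₁}]∘[ρ], [λ⊞_{v,ν₂}]∘[ρ])` with `ν₁ ⤳ ν₂`, homotopies `𝒟_[ρ] ◁ (ι⊞ along the chain)`, with the four laws of Def 3.5 (ii)
— GIVEN the `ι⊞`-squares of Def 5.4 (iii) at every place (which any observable structures `S_log⊞` supply).
[cite: MochizukiAbsTopIII2015, Definition 3.5 (ii) p.75] -/
noncomputable def lamRelLifts (L : LogFrobeniusSetting Vmod isArc) (hsq : ∀ v : Vmod, L.IotaCoreSquaresCommute v) :
    L.monoTeleDiagram.RelLifts where
  W := NW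
  Rel := fun _ _ p q => NRel p q
  θ := fun _ _ hw _ _ h => L.NθAt hw h
  rel_refl_left := fun _ _ _ _ hw h => nrel_refl_left hw h
  rel_refl_right := fun _ _ _ _ hw h => nrel_refl_right hw h
  rel_trans := fun _ _ _ _ _ hw h₁ h₂ => nrel_trans hw h₁ h₂
  rel_precomp := fun _ _ _ r _ _ hw h => nrel_precomp r hw h
  rel_postcomp := fun _ _ _ _ _ t hw hw' h => nrel_postcomp t hw hw' h
  θ_self := by
    intro a w hw p h
    obtain ⟨v, rfl⟩ := eq_of_nw hw
    exact L.θN_self h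
  θ_trans := by
    intro a w hw p q r h₁ h₂ h₃
    obtain ⟨v, rfl⟩ := eq_of_nw hw
    exact L.θN_trans (hsq v) h₁ h₂ h₃
  θ_precomp_heq := by
    intro c a w hw r p q h h'
    obtain ⟨v, rfl⟩ := eq_of_nw hw
    exact L.θN_precomp_heq r h h'
  θ_postcomp_heq := by
    intro a w w' hw hw' p q t h h'
    obtain ⟨v, rfl⟩ := eq_of_nw hw
    obtain rfl : nplusVx (isArc := isArc) v = w' := Path.eq_of_length_zero t (length_eq_zero_of_path_nplus hw' t)
    exact L.θN_postcomp_heq t h h'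

section Facts

variable (L : LogFrobeniusSetting Vmod isArc) {v : Vmod} {a : (monoTeleShape Vmod isArc).Vertex}

/-- the vertex set of the datum. [cite: MochizukiAbsTopIII2015, Cor 5.10 (iv)(c) p.148] -/
theorem lamRelLifts_W (hsq : ∀ v : Vmod, L.IotaCoreSquaresCommute v) (w : (monoTeleShape Vmod isArc).Vertex) :
    (L.lamRelLifts hsq).W w ↔ NW w := Iff.rfl

/-- the related pairs of the datum. [cite: MochizukiAbsTopIII2015, Cor 5.10 (iv)(c) p.148] -/
theorem lamRelLifts_rel_iff (hsq : ∀ v : Vmod, L.IotaCoreSquaresCommute v) {w : (monoTeleShape Vmod isArc).Vertex}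
    (p q : Path a w) : (L.lamRelLifts hsq).Rel p q ↔ NRel p q := Iff.rfl

/-- the homotopy of the datum at `𝒩⊞_v` is `θN`. [cite: MochizukiAbsTopIII2015, Definition 3.5 (ii) p.75] -/
theorem lamRelLifts_θ (hsq : ∀ v : Vmod, L.IotaCoreSquaresCommute v) {p q : Path a (nplusVx (isArc := isArc) v)}
    (h : NRelN v p q) :
    (L.lamRelLifts hsq).θ (show (L.lamRelLifts hsq).W (nplusVx v) from nw_nplusVx (isArc := isArc) v)
      (show (L.lamRelLifts hsq).Rel p q from h) = L.θN h := rfl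

/-- **the core-edge generator pair is witnessed**: `([λ⊞_{v,ν₁}], [λ⊞_{v,ν₂}])` (empty prefix) for an edge `ε : ν₁ → ν₂` of `Γ⃗×_v`.
[cite: MochizukiAbsTopIII2015, Cor 5.5 (iii) p. 131] -/
def NWit.ofInCore (v : Vmod) {ν₁ ν₂ : LogVertex (isArc v)} (ε : LogEdgeTS (isArc v) ν₁ ν₂) (hε : ε.InCore) :
    NWit (isArc := isArc) v ν₁ ν₂ hε.isCross_src hε.isCross_tgt
      (Path.nil.cons (lamE v ν₁ hε.isCross_src)) (Path.nil.cons (lamE v ν₂ hε.isCross_tgt)) :=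
  ⟨Path.nil, rfl, rfl⟩

/-- the core-edge generator pair is related at `𝒩⊞_v`. [cite: MochizukiAbsTopIII2015, Cor 5.5 (iii) p. 131] -/
theorem nrelN_lamE (v : Vmod) {ν₁ ν₂ : LogVertex (isArc v)} (ε : LogEdgeTS (isArc v) ν₁ ν₂) (hε : ε.InCore) :
    NRelN (isArc := isArc) v (Path.nil.cons (lamE v ν₁ hε.isCross_src)) (Path.nil.cons (lamE v ν₂ hε.isCross_tgt)) :=
  nrelN_of_wit (NWit.ofInCore v ε hε) (LogVertex.Reach.of_inCore hε)

/-- **its homotopy is the untwisted `ι⊞_{v,ε}`**, componentwise (up to the casts of the empty prefix).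
[cite: MochizukiAbsTopIII2015, Cor 5.5 (iii) p. 131] -/
theorem θN_lamE_app_heq (v : Vmod) {ν₁ ν₂ : LogVertex (isArc v)} (ε : LogEdgeTS (isArc v) ν₁ ν₂) (hε : ε.InCore)
    (h : NRelN (isArc := isArc) v (Path.nil.cons (lamE v ν₁ hε.isCross_src)) (Path.nil.cons (lamE v ν₂ hε.isCross_tgt)))
    (y : L.X) : (L.θN h).app y ≍ (L.iotaCore v ε hε).app y := by
  rw [L.θN_eq h (NWit.ofInCore v ε hε) (LogVertex.Reach.of_inCore hε)]
  refine ((NWit.ofInCore v ε hε).θ_app_heq L (LogVertex.Reach.of_inCore hε) y).trans ?_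
  change (L.lamChain v (LogVertex.Reach.of_inCore hε)).app
    ((L.monoTeleDiagram.pathFunctor (Path.nil : Path (boxVx Vmod isArc) (boxVx Vmod isArc))).obj y) ≍ _
  rw [DiagramOfCategories.pathFunctor_nil]
  exact heq_of_eq (NatTrans.congr_app (L.lamChain_inCore v ε hε) y)

end Facts

/-! ## The homotopies lie over the structure isomorphisms -/

section Over

variable (L : LogFrobeniusSetting Vmod isArc)
  (hN : ∀ v : Vmod, L.monoN v ⋙ L.toEmono v ≅ L.toE v ⋙ L.monoAn)
  (hψ : ∀ (w : Vmod) (j : {ν : LogVertex (isArc w) // ν.IsCross}),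
    L.ψAnMono w j ⋙ L.forgetMono w ⋙ L.toEmono w ≅ L.κAnMono.inverse)
  {v : Vmod} {a : (monoTeleShape Vmod isArc).Vertex}

/-- the structure functor at `𝒩⊞_v` applied to a morphism: `(ℰ⊢ ⥲ An⊢)((ℰ• → ℰ⊢)((𝒩_v → ℰ•)((𝒩⊞_v → 𝒩_v)(f))))`.
[cite: MochizukiAbsTopIII2015, Cor 5.10 (iv)(b) p.147] -/
theorem monoTeleOver_N_nplus_map {y y' : L.Nplus v} (f : y ⟶ y') :
    ((L.monoTeleOver hN hψ).N (nplusVx v)).map f =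
      L.κAnMono.functor.map (L.monoAn.map ((L.toE v).map ((L.forget v).map f))) := rfl

/-- `pathIso` of a path ending with `λ⊞_{v,ν}`, componentwise, up to HEq: the structure isomorphism of `λ⊞_{v,ν}` (`lamOver` under
`ℰ• → ℰ⊢ ⥲ An⊢`) after that of the prefix. [cite: MochizukiAbsTopIII2015, Remark 3.5.1 p.78] -/
theorem pathIso_cons_lamE_hom_app_heq (R : Path a (boxVx Vmod isArc)) (ν : LogVertex (isArc v)) (hν : ν.IsCross)
    (x : L.monoTeleDiagram.obj a) :
    ((L.monoTeleOver hN hψ).pathIso (R.cons (lamE v ν hν))).hom.app x ≍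
      L.κAnMono.functor.map (L.monoAn.map ((L.lamOver v ν).hom.app ((L.monoTeleDiagram.pathFunctor R).obj x))) ≫
        ((L.monoTeleOver hN hψ).pathIso R).hom.app x := by
  refine (L.pathIso_cons_hom_app_heq hN hψ R (lamE v ν hν) x).trans ?_
  rw [L.μ_lamE_app hN hψ]
  try rfl

/-- … and the inverse. [cite: MochizukiAbsTopIII2015, Remark 3.5.1 p.78] -/
theorem pathIso_cons_lamE_inv_app_heq (R : Path a (boxVx Vmod isArc)) (ν : LogVertex (isArc v)) (hν : ν.IsCross)
    (x : L.monoTeleDiagram.obj a) :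
    ((L.monoTeleOver hN hψ).pathIso (R.cons (lamE v ν hν))).inv.app x ≍
      ((L.monoTeleOver hN hψ).pathIso R).inv.app x ≫
        L.κAnMono.functor.map (L.monoAn.map ((L.lamOver v ν).inv.app ((L.monoTeleDiagram.pathFunctor R).obj x))) := by
  have e₁ : (L.monoTeleDiagram.pathFunctor (R.cons (lamE v ν hν)) ⋙ (L.monoTeleOver hN hψ).N (nplusVx v)).obj x =
      L.κAnMono.functor.obj (L.monoAn.obj ((L.lam v ν ⋙ L.forget v ⋙ L.toE v).obj
        ((L.monoTeleDiagram.pathFunctor R).obj x))) := by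
    rw [DiagramOfCategories.pathFunctor_cons]; rfl
  have key : ((L.monoTeleOver hN hψ).pathIso (R.cons (lamE v ν hν))).hom.app x =
      eqToHom e₁ ≫ (L.κAnMono.functor.map (L.monoAn.map ((L.lamOver v ν).hom.app ((L.monoTeleDiagram.pathFunctor R).obj x))) ≫
        ((L.monoTeleOver hN hψ).pathIso R).hom.app x) ≫ eqToHom rfl :=
    (conj_eqToHom_iff_heq _ _ e₁ rfl).mpr (L.pathIso_cons_lamE_hom_app_heq hN hψ R ν hν x)
  -- invert the isomorphism `pathIso.app x`
  have hiso : ((L.monoTeleOver hN hψ).pathIso (R.cons (lamE v ν hν))).app x =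
      eqToIso e₁ ≪≫ (L.κAnMono.functor.mapIso (L.monoAn.mapIso ((L.lamOver v ν).app
        ((L.monoTeleDiagram.pathFunctor R).obj x))) ≪≫ ((L.monoTeleOver hN hψ).pathIso R).app x) := by
    ext
    rw [Iso.app_hom, key]
    simp only [Iso.trans_hom, eqToIso.hom, Functor.mapIso_hom, Iso.app_hom, eqToHom_refl, Category.comp_id]
  have hinv := congrArg Iso.inv hiso
  rw [Iso.app_inv] at hinv
  rw [hinv]
  simp only [Iso.trans_inv, eqToIso.inv, Functor.mapIso_inv, Iso.app_inv, Category.assoc]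
  exact heq_comp rfl rfl e₁ HEq.rfl (comp_eqToHom_heq _ _)

/-- ★ **the homotopies at `𝒩⊞_v` lie over the structure isomorphisms** (Rmk 3.5.1), GIVEN abc-iut-L4-t3's `IotaOver`: the image of
`θN` under the structure functor of `𝒩⊞_v` is `pathIso p ∘ (pathIso q)⁻¹` — because `ι⊞` along the chain lies over `Th•[Z]`
(`lamChain_over_app`) and the structure isomorphism of `λ⊞_{v,ν}` is `lamOver`. [cite: MochizukiAbsTopIII2015, Remark 3.5.1 p.78] -/
theorem θN_over (hιO : L.IotaOver) {p q : Path a (nplusVx (isArc := isArc) v)} (h : NRelN v p q) (x : L.monoTeleDiagram.obj a) :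
    ((L.monoTeleOver hN hψ).N (nplusVx v)).map ((L.θN h).app x) =
      ((L.monoTeleOver hN hψ).pathIso p).hom.app x ≫ ((L.monoTeleOver hN hψ).pathIso q).inv.app x := by
  obtain ⟨ν₁, ν₂, hν₁, hν₂, hreach, ⟨w⟩⟩ := h
  rw [L.θN_eq _ w hreach]
  obtain ⟨R, rfl, rfl⟩ := w
  apply eq_of_heq
  -- the left-hand side: strip the casts, read `ι⊞` along the chain over `Th•[Z]`
  have hL : ((L.monoTeleOver hN hψ).N (nplusVx v)).map
      ((NWit.θ L (⟨R, rfl, rfl⟩ : NWit v ν₁ ν₂ hν₁ hν₂ _ _) hreach).app x) ≍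
      ((L.monoTeleOver hN hψ).N (nplusVx v)).map
        ((L.lamChain v hreach).app ((L.monoTeleDiagram.pathFunctor R).obj x)) :=
    map_heq' _ (Functor.congr_obj (NWit.pathFunctor_left L (⟨R, rfl, rfl⟩ : NWit v ν₁ ν₂ hν₁ hν₂ _ _)) x)
      (Functor.congr_obj (NWit.pathFunctor_right L (⟨R, rfl, rfl⟩ : NWit v ν₁ ν₂ hν₁ hν₂ _ _)) x)
      (NWit.θ_app_heq L (⟨R, rfl, rfl⟩ : NWit v ν₁ ν₂ hν₁ hν₂ _ _) hreach x)
  refine hL.trans ?_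
  rw [monoTeleOver_N_nplus_map, L.lamChain_over_app hιO v hreach]
  change L.κAnMono.functor.map (L.monoAn.map
    ((L.lamOver v ν₁).hom.app ((L.monoTeleDiagram.pathFunctor R).obj x) ≫
      (L.lamOver v ν₂).inv.app ((L.monoTeleDiagram.pathFunctor R).obj x))) ≍ _
  rw [Functor.map_comp, Functor.map_comp]
  -- the right-hand side: `π_p ∘ π_q⁻¹` with `π_{[λ]∘[ρ]} = (κ ∘ monoAn)(lamOver) ∘ π_ρ`
  refine HEq.symm ((heq_comp ?_ rfl ?_ (L.pathIso_cons_lamE_hom_app_heq hN hψ R ν₁ hν₁ x)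
    (L.pathIso_cons_lamE_inv_app_heq hN hψ R ν₂ hν₂ x)).trans ?_)
  · rw [DiagramOfCategories.pathFunctor_cons]; rfl
  · rw [DiagramOfCategories.pathFunctor_cons]; rfl
  · exact heq_of_eq ((Category.assoc _ _ _).trans (congrArg
      (fun k => L.κAnMono.functor.map (L.monoAn.map ((L.lamOver v ν₁).hom.app
        ((L.monoTeleDiagram.pathFunctor R).obj x))) ≫ k)
      (((L.monoTeleOver hN hψ).pathIso R).hom_inv_id_app_assoc x _)))

end Over

end LogFrobeniusSetting

end Literature.AnabelianGeometry.AbsoluteAnabelian
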